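import Summits.ResolutionOfSingularities.ResolutionOfSingularities.Theorems.PurelyInseparableDim4JointMixedComputations
import HarnessLib

/-!
# Purely inseparable four-folds: the MIXED instance — the SURFACE CHILD over the 3-fold is DEAD (brick S3 (c) «joint point∘coordinate
# chains», part 30a′, cell `res-dim4-pi`)

[OURS · counted 0] (D-0157 DOOR 2; desk WORD #66 (4)(c), #74 (g), #99 (d); frame `PIDim4.TerminationImpliesOrderReduction`,
S3 (c); host item stmt-ResolutionOfSingularities-16155, helper). Nothing here proves resolution of singularities in
dimension ≥ 4 / characteristic `p` — NOT here, not anywhere in this programme.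

`G = x₂^{2p}x₃ − x₂^p x₃ + x₂^p x₃^p x₄ + x₁ x₂^p x₄^p + x₁^p x₂` (part 30a). Here: the two charts of the blow-up of the surface child
`V(z, y₁, y₂)` applied to `G` (`chartTransform_pair_zero/one_G_mixed`) and **`not_isEquimultiplePoint_child_mixed`** (`p ≥ 3`): no pair over
the child is equimultiple — in the `y₁`-chart the linear coefficient of `y₃` is `−b₂^p` and then `y₁y₂` has coefficient `1`; in the
`y₂`-chart the linear coefficient of `y₃` is `−1`.

AI-produced formalisation, weaker than expert review. bears_on: LADDER-RESOLUTION:D157-DOOR2 (res-dim4-pi · S3 (c) joint v2 · mixed instance, child).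
-/

set_option linter.dupNamespace false -- D-0017: single-problem summit path `Summit.<S>.<S>.…` by design

noncomputable section

open MvPolynomial Finset CategoryTheory AlgebraicGeometry Opposite TopologicalSpace

namespace Summit.ResolutionOfSingularities.ResolutionOfSingularities.Theorems.PIDim4

open Literature.AlgebraicGeometry.Resolution
open Literature.AlgebraicGeometry.Resolution.Hauser2010
open Literature.AlgebraicGeometry.Resolution.AffinePointBlowup (P A γ coord Wtop ξ)

namespace Equimultiple

section MixedChild

variable {K : Type} [Field K] {p : ℕ} [hp : Fact p.Prime] [CharP K p]

/-! ## §3 The surface child `V(z, y₁, y₂)` over the 3-fold is DEAD -/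

omit hp [CharP K p] in
/-- Degrees in `{y₁, y₂}` of the five exponents of `G`. [folklore] -/
theorem degIn_pair_G_mixed :
    CentreBlowup.degIn ({0, 1} : Finset (Fin 4)) (Finsupp.single 1 (2 * p) + Finsupp.single 2 1) = 2 * p ∧
    CentreBlowup.degIn ({0, 1} : Finset (Fin 4)) (Finsupp.single 1 p + Finsupp.single 2 1) = p ∧
    CentreBlowup.degIn ({0, 1} : Finset (Fin 4)) (Finsupp.single 1 p + Finsupp.single 2 p + Finsupp.single 3 1) = p ∧
    CentreBlowup.degIn ({0, 1} : Finset (Fin 4)) (Finsupp.single 0 1 + Finsupp.single 1 p + Finsupp.single 3 p) = 1 + p ∧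
    CentreBlowup.degIn ({0, 1} : Finset (Fin 4)) (Finsupp.single 0 p + Finsupp.single 1 1) = p + 1 := by
  refine ⟨?_, ?_, ?_, ?_, ?_⟩ <;> simp [degIn_pair]

omit hp [CharP K p] in
/-- **The `y₁`-chart of the blow-up of `V(z, y₁, y₂)` applied to `G`** reads
`y₁^p y₂^{2p} y₃ − y₂^p y₃ + y₂^p y₃^p y₄ + y₁ y₂^p y₄^p + y₁ y₂`. [cite: HauserPerlega2019PRIMS, §2 (the x₁-chart)] -/
theorem chartTransform_pair_zero_G_mixed :
    CentreBlowup.chartTransform p ({0, 1} : Finset (Fin 4)) 0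
        (X 1 ^ (2 * p) * X 2 - X 1 ^ p * X 2 + X 1 ^ p * X 2 ^ p * X 3 + X 0 * X 1 ^ p * X 3 ^ p + X 0 ^ p * X 1 :
          MvPolynomial (Fin 4) K) =
      X 0 ^ p * X 1 ^ (2 * p) * X 2 - X 1 ^ p * X 2 + X 1 ^ p * X 2 ^ p * X 3 + X 0 * X 1 ^ p * X 3 ^ p + X 0 * X 1 := by
  obtain ⟨d1, d2, d3, d4, d5⟩ := degIn_pair_G_mixed (p := p)
  rw [G_mixed_eq_monomial_add, CentreBlowup.chartTransform_add, CentreBlowup.chartTransform_add, CentreBlowup.chartTransform_add,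
    CentreBlowup.chartTransform_monomial_add_monomial, CentreBlowup.chartTransform_monomial, CentreBlowup.chartTransform_monomial,
    CentreBlowup.chartTransform_monomial]
  simp only [CentreBlowup.chartExponent, d1, d2, d3, d4, d5]
  have e1 : (Finsupp.single 1 (2 * p) + Finsupp.single 2 1 : Fin 4 →₀ ℕ).update 0 (2 * p - p) =
      Finsupp.single 0 p + Finsupp.single 1 (2 * p) + Finsupp.single 2 1 := by
    ext i; fin_cases i <;> simp [Finsupp.update_apply]; omega
  have e2 : (Finsupp.single 1 p + Finsupp.single 2 1 : Fin 4 →₀ ℕ).update 0 (p - p) = Finsupp.single 1 p + Finsupp.single 2 1 := by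
    ext i; fin_cases i <;> simp [Finsupp.update_apply]
  have e3 : (Finsupp.single 1 p + Finsupp.single 2 p + Finsupp.single 3 1 : Fin 4 →₀ ℕ).update 0 (p - p) =
      Finsupp.single 1 p + Finsupp.single 2 p + Finsupp.single 3 1 := by
    ext i; fin_cases i <;> simp [Finsupp.update_apply]
  have e4 : (Finsupp.single 0 1 + Finsupp.single 1 p + Finsupp.single 3 p : Fin 4 →₀ ℕ).update 0 (1 + p - p) =
      Finsupp.single 0 1 + Finsupp.single 1 p + Finsupp.single 3 p := by
    ext i; fin_cases i <;> simp [Finsupp.update_apply]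
  have e5 : (Finsupp.single 0 p + Finsupp.single 1 1 : Fin 4 →₀ ℕ).update 0 (p + 1 - p) = Finsupp.single 0 1 + Finsupp.single 1 1 := by
    ext i; fin_cases i <;> simp [Finsupp.update_apply]
  have h₁ : (monomial (Finsupp.single 0 p + Finsupp.single 1 (2 * p) + Finsupp.single 2 1) (1 : K) : MvPolynomial (Fin 4) K) =
      X 0 ^ p * X 1 ^ (2 * p) * X 2 := by
    rw [X_pow_eq_monomial, X_pow_eq_monomial, X, monomial_mul, monomial_mul, mul_one, mul_one]
  have h₃ : (monomial (Finsupp.single 1 p + Finsupp.single 2 p + Finsupp.single 3 1) (1 : K) : MvPolynomial (Fin 4) K) =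
      X 1 ^ p * X 2 ^ p * X 3 := by
    rw [X_pow_eq_monomial, X_pow_eq_monomial, X, monomial_mul, monomial_mul, mul_one, mul_one]
  have h₄ : (monomial (Finsupp.single 0 1 + Finsupp.single 1 p + Finsupp.single 3 p) (1 : K) : MvPolynomial (Fin 4) K) =
      X 0 * X 1 ^ p * X 3 ^ p := by
    rw [X_pow_eq_monomial, X_pow_eq_monomial, X, monomial_mul, monomial_mul, mul_one, mul_one]
  have h₅ : (monomial (Finsupp.single 0 1 + Finsupp.single 1 1) (1 : K) : MvPolynomial (Fin 4) K) = X 0 * X 1 := by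
    rw [X, X, monomial_mul, mul_one]
  have h₂ : (monomial (Finsupp.single 1 p + Finsupp.single 2 1) (-1 : K) : MvPolynomial (Fin 4) K) = -(X 1 ^ p * X 2) := by
    rw [X_pow_mul_X_eq_monomial, map_neg]
  rw [e1, e2, e3, e4, e5, h₁, h₂, h₃, h₄, h₅]
  ring

omit hp [CharP K p] in
/-- **The `y₂`-chart of the blow-up of `V(z, y₁, y₂)` applied to `G`** reads `y₂^p y₃ − y₃ + y₃^p y₄ + y₁ y₂ y₄^p + y₁^p y₂`.
[cite: HauserPerlega2019PRIMS, §2 (the x₁-chart)] -/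
theorem chartTransform_pair_one_G_mixed :
    CentreBlowup.chartTransform p ({0, 1} : Finset (Fin 4)) 1
        (X 1 ^ (2 * p) * X 2 - X 1 ^ p * X 2 + X 1 ^ p * X 2 ^ p * X 3 + X 0 * X 1 ^ p * X 3 ^ p + X 0 ^ p * X 1 :
          MvPolynomial (Fin 4) K) =
      X 1 ^ p * X 2 - X 2 + X 2 ^ p * X 3 + X 0 * X 1 * X 3 ^ p + X 0 ^ p * X 1 := by
  obtain ⟨d1, d2, d3, d4, d5⟩ := degIn_pair_G_mixed (p := p)
  rw [G_mixed_eq_monomial_add, CentreBlowup.chartTransform_add, CentreBlowup.chartTransform_add, CentreBlowup.chartTransform_add,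
    CentreBlowup.chartTransform_monomial_add_monomial, CentreBlowup.chartTransform_monomial, CentreBlowup.chartTransform_monomial,
    CentreBlowup.chartTransform_monomial]
  simp only [CentreBlowup.chartExponent, d1, d2, d3, d4, d5]
  have e1 : (Finsupp.single 1 (2 * p) + Finsupp.single 2 1 : Fin 4 →₀ ℕ).update 1 (2 * p - p) = Finsupp.single 1 p + Finsupp.single 2 1 := by
    ext i; fin_cases i <;> simp [Finsupp.update_apply]; omega
  have e2 : (Finsupp.single 1 p + Finsupp.single 2 1 : Fin 4 →₀ ℕ).update 1 (p - p) = Finsupp.single 2 1 := by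
    ext i; fin_cases i <;> simp [Finsupp.update_apply]
  have e3 : (Finsupp.single 1 p + Finsupp.single 2 p + Finsupp.single 3 1 : Fin 4 →₀ ℕ).update 1 (p - p) =
      Finsupp.single 2 p + Finsupp.single 3 1 := by
    ext i; fin_cases i <;> simp [Finsupp.update_apply]
  have e4 : (Finsupp.single 0 1 + Finsupp.single 1 p + Finsupp.single 3 p : Fin 4 →₀ ℕ).update 1 (1 + p - p) =
      Finsupp.single 0 1 + Finsupp.single 1 1 + Finsupp.single 3 p := by
    ext i; fin_cases i <;> simp [Finsupp.update_apply]
  have e5 : (Finsupp.single 0 p + Finsupp.single 1 1 : Fin 4 →₀ ℕ).update 1 (p + 1 - p) = Finsupp.single 0 p + Finsupp.single 1 1 := by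
    ext i; fin_cases i <;> simp [Finsupp.update_apply]
  have h₂ : (monomial (Finsupp.single 2 1) (-1 : K) : MvPolynomial (Fin 4) K) = - X 2 := by
    rw [X, ← map_neg]
  have h₄ : (monomial (Finsupp.single 0 1 + Finsupp.single 1 1 + Finsupp.single 3 p) (1 : K) : MvPolynomial (Fin 4) K) =
      X 0 * X 1 * X 3 ^ p := by
    rw [X_pow_eq_monomial, X, X, monomial_mul, monomial_mul, mul_one, mul_one]
  rw [e1, e2, e3, e4, e5, ← X_pow_mul_X_eq_monomial (p := p) 1 2, h₂, ← X_pow_mul_X_eq_monomial (p := p) 2 3, h₄,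
    ← X_pow_mul_X_eq_monomial (p := p) 0 1]
  ring

omit hp in
/-- **NO PAIR OVER THE SURFACE CHILD IS EQUIMULTIPLE** (`p ≥ 3`): in the `y₁`-chart the linear coefficient of `y₃` is `−b₂^p`
(so `b₂ = 0`) and then `y₁y₂` has coefficient `1`; in the `y₂`-chart the linear coefficient of `y₃` is `b₂^p − 1 = −1`.
[cite: Hauser2010, §F (equiconstant points)] -/
theorem not_isEquimultiplePoint_child_mixed [DecidableEq K] (hp3 : 3 ≤ p) {j : Fin 4} (hj : j ∈ ({0, 1} : Finset (Fin 4)))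
    (b : Fin 4 → K) (hbj : b j = 0) (s : State K)
    (hs : s.F = X 1 ^ (2 * p) * X 2 - X 1 ^ p * X 2 + X 1 ^ p * X 2 ^ p * X 3 + X 0 * X 1 ^ p * X 3 ^ p + X 0 ^ p * X 1) :
    ¬ CentreBlowup.IsEquimultiplePoint p ({0, 1} : Finset (Fin 4)) j b s := by
  have hp1 : 1 < p := by omega
  intro h
  unfold CentreBlowup.IsEquimultiplePoint CentreBlowup.pointTransform at h
  rw [hs] at h
  rcases Finset.mem_insert.mp hj with rfl | hj1
  · rw [chartTransform_pair_zero_G_mixed] at h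
    -- the linear coefficient of `y₃`: `b₂ = 0`
    have h2 := h (Finsupp.single 2 1) (Finsupp.single_ne_zero.mpr one_ne_zero) (by rw [Finsupp.degree_single]; exact hp1)
    rw [coeff_single_one_translate] at h2
    simp [(pderiv (2 : Fin 4)).leibniz_pow, hbj, zero_pow (show p ≠ 0 by omega)] at h2
    have hb1 : b 1 = 0 := h2.1
    -- the coefficient of `y₁ y₂` is `1`
    have h01 := h (Finsupp.single 0 1 + Finsupp.single 1 1) (by
        intro h0; have := DFunLike.congr_fun h0 0; simp at this)
      (by rw [map_add, Finsupp.degree_single, Finsupp.degree_single]; omega)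
    have hX : (X 0 : MvPolynomial (Fin 4) K) ^ p = X 0 * X 0 ^ (p - 1) := by
      rw [← pow_succ', Nat.sub_add_cancel hp1.le]
    have hdec : (X 0 ^ p * X 1 ^ (2 * p) * X 2 - X 1 ^ p * X 2 + X 1 ^ p * X 2 ^ p * X 3 + X 0 * X 1 ^ p * X 3 ^ p + X 0 * X 1 :
        MvPolynomial (Fin 4) K) =
        X 0 * (X 0 ^ (p - 1) * X 1 ^ (2 * p) * X 2 + X 1 ^ p * X 3 ^ p + X 1) +
          monomial (Finsupp.single 1 p) 1 * (X 2 ^ p * X 3 - X 2) := by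
      rw [← X_pow_eq_monomial, hX]; ring
    have htr : PointBlowup.translate b (monomial (Finsupp.single 1 p) (1 : K) * (X 2 ^ p * X 3 - X 2)) =
        monomial (Finsupp.single 1 p) 1 * PointBlowup.translate b (X 2 ^ p * X 3 - X 2) := by
      unfold PointBlowup.translate
      rw [map_mul, ← X_pow_eq_monomial, map_pow, aeval_X, hb1, C_0, add_zero]
    have hsplit : ∀ A B : MvPolynomial (Fin 4) K, PointBlowup.translate b (A + B) = PointBlowup.translate b A + PointBlowup.translate b B :=
      fun A B => by unfold PointBlowup.translate; rw [map_add]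
    rw [hdec, hsplit, coeff_add, coeff_pair_translate_X_mul 0 1 b hbj, htr, coeff_monomial_mul', if_neg (by
      intro hle; have := hle 1; simp at this; omega), add_zero] at h01
    simp [(pderiv (1 : Fin 4)).leibniz_pow] at h01
  · have hj' : j = 1 := Finset.mem_singleton.mp hj1
    subst hj'
    rw [chartTransform_pair_one_G_mixed] at h
    have h2 := h (Finsupp.single 2 1) (Finsupp.single_ne_zero.mpr one_ne_zero) (by rw [Finsupp.degree_single]; exact hp1)
    rw [coeff_single_one_translate] at h2
    simp [(pderiv (2 : Fin 4)).leibniz_pow, hbj, zero_pow (by omega : p ≠ 0)] at h2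

end MixedChild

end Equimultiple

end Summit.ResolutionOfSingularities.ResolutionOfSingularities.Theorems.PIDim4

end
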